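import Summits.QuantumFields.YangMills.Theorems.SqueezedSkewnessThermalLimitSpectralSums
import Summits.QuantumFields.YangMills.Theorems.SqueezedSkewnessTorusKLWindow
import Summits.QuantumFields.YangMills.Theorems.SqueezedSkewnessTorusKLMixtureAlgebra
import HarnessLib

/-!
# Route `SqueezedSkewness`, crux `SpectralIdentificationL` (stmt-QuantumFields-22796), stub `stub_osData` — OS-DATA layer (O4a):
# GENERIC TOOLS FOR THE THERMODYNAMIC LIMIT OVER THE REFERENCE STATES

Pure analysis / algebra (theorems only), used by layer (O4b) `…OSDataVacuumDatum` to pass from the period-uniform class sums of the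
torus (`TorusKL.exists_complex_spectral_package_pos`) to the thermodynamic limit along the reference states `k = (c, j)`:

* `exists_argmax_of_summable_sq` — positive weights with `Σ λ_k² < ∞` attain their maximum (the TOP reference state `λ₀`; no simplicity /
  Perron–Frobenius is used anywhere: a degenerate top class is allowed);
* `hasSum_sigma_re` — a complex `HasSum` over the classes of `c ↦ λ_c^n Σ_j z_{c,j}` with bounded `z` is a real `HasSum` over the
  sigma type of `k ↦ λ_k^n Re z_k` (absolute convergence from `Σ λ^n < ∞`);
* `tsum_top_eq_sum` — the top-class indicator sums of `SpectralSumLimit.tendsto_tsum_pow_mul_div_tsum_pow` are finite sums over the top fibre;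
* `norm_proj_orth_le`, `norm_projected_le` — `‖(1 − |e⟩⟨e|) v‖ ≤ ‖v‖` and the contraction property `‖λ⁻¹ (1−R) A (1−R) v‖ ≤ ‖v‖` when
  `‖A g‖ ≤ λ ‖g‖`.

Seat `ym-line-fcl-p3` g17 (cell ym-idea-1; free hands); route-independent imports; `[folklore]`; nothing about a summit, NT or the mass gap.
References: I. Montvay, G. Münster, *Quantum Fields on a Lattice* (1994) §1.5.2 (1.195)–(1.196) [cite: MontvayMunster1994, §1.5.2];
M. Reed, B. Simon, *Methods of Modern Mathematical Physics I* (1980) §VI [cite: ReedSimonI1980, Thm VI.16].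
-/

set_option autoImplicit false

noncomputable section

open Filter Topology Function
open scoped InnerProductSpace ComplexConjugate BigOperators

namespace Summit.QuantumFields.YangMills.Theorems.TorusKL.OSData

/-! ## §1 The top reference state -/

/-- **Positive square-summable weights attain their maximum.** [cite: ReedSimonI1980, Thm VI.16] -/
theorem exists_argmax_of_summable_sq {κ : Type*} (lam : κ → ℝ) (hpos : ∀ k, 0 < lam k) (hsq : Summable fun k => lam k ^ 2)
    (k₁ : κ) : ∃ k₀ : κ, ∀ k, lam k ≤ lam k₀ := by
  classical
  have hfin : {k | ¬ (lam k ^ 2 < lam k₁ ^ 2)}.Finite := by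
    have h := hsq.tendsto_cofinite_zero
    have hmem : Set.Iio (lam k₁ ^ 2) ∈ 𝓝 (0 : ℝ) := Iio_mem_nhds (pow_pos (hpos k₁) 2)
    exact Filter.eventually_cofinite.mp (h hmem)
  have hk₁ : k₁ ∈ hfin.toFinset := by simp
  obtain ⟨k₀, hk₀, hmax⟩ := hfin.toFinset.exists_max_image lam ⟨k₁, hk₁⟩
  refine ⟨k₀, fun k => ?_⟩
  by_cases hk : lam k ^ 2 < lam k₁ ^ 2
  · have h1 : lam k < lam k₁ := lt_of_pow_lt_pow_left₀ 2 (hpos k₁).le hk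
    exact h1.le.trans (hmax k₁ hk₁)
  · exact hmax k (by rw [Set.Finite.mem_toFinset]; exact hk)

/-! ## §2 From complex class sums to real sums over the reference states -/

/-- **Real part of a class sum, as an absolutely convergent sum over the sigma type.**  If `Σ_c λ_c^n (Σ_j z_{c,j}) = v` (`HasSum` in `ℂ`,
`v` real), `λ ≥ 0`, `Σ_k λ_k^n < ∞` over `k = (c, j)` and `‖z_k‖ ≤ M`, then `Σ_k λ_k^n Re z_k = v`. [cite: MontvayMunster1994, §1.5.2] -/
theorem hasSum_sigma_re {C : Type*} {β : C → Type*} [∀ c, Fintype (β c)] (lam : C → ℝ) (n : ℕ) (z : (Σ c, β c) → ℂ)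
    {v M : ℝ} (hz : ∀ k, ‖z k‖ ≤ M) (hlam : ∀ c, 0 ≤ lam c) (hsum : Summable fun k : (Σ c, β c) => lam k.1 ^ n)
    (h : HasSum (fun c => ((lam c : ℝ) : ℂ) ^ n * ∑ j : β c, z ⟨c, j⟩) (v : ℂ)) :
    HasSum (fun k : (Σ c, β c) => lam k.1 ^ n * (z k).re) v := by
  have hre := Complex.hasSum_re h
  simp only [Complex.ofReal_re, ← Complex.ofReal_pow, Complex.re_ofReal_mul, Complex.re_sum, Finset.mul_sum] at hre
  have hs : Summable fun k : (Σ c, β c) => ‖lam k.1 ^ n * (z k).re‖ := by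
    refine Summable.of_nonneg_of_le (fun k => norm_nonneg _) (fun k => ?_) (hsum.mul_left (max M 0))
    rw [norm_mul, Real.norm_eq_abs, abs_of_nonneg (pow_nonneg (hlam k.1) n), mul_comm]
    refine mul_le_mul_of_nonneg_right ?_ (pow_nonneg (hlam k.1) n)
    exact ((Complex.abs_re_le_norm (z k)).trans (hz k)).trans (le_max_left _ _)
  exact HasSum.sigma_of_hasSum hre (fun _ => hasSum_fintype _) hs.of_norm

/-- **Top-class indicator sums are finite sums over the top fibre.**  For an injective label `lam` of the classes,
`Σ'_k [λ_k = λ_{c₀}] g k = Σ_{j ∈ fibre c₀} g (c₀, j)`. [folklore] -/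
theorem tsum_top_eq_sum {C : Type*} {β : C → Type*} [∀ c, Fintype (β c)] (lam : C → ℝ) (hinj : Injective lam) (c₀ : C)
    (g : (Σ c, β c) → ℝ) :
    (∑' k : (Σ c, β c), if lam k.1 = lam c₀ then g k else 0) = ∑ j : β c₀, g ⟨c₀, j⟩ := by
  classical
  rw [Window.tsum_eq_sum_of_support (fun j : β c₀ => (⟨c₀, j⟩ : Σ c, β c)) sigma_mk_injective
    (fun k : (Σ c, β c) => if lam k.1 = lam c₀ then g k else 0) ?_]
  · exact Finset.sum_congr rfl fun j _ => if_pos rfl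
  · rintro ⟨c, j⟩ hk
    simp only
    rw [if_neg]
    intro hc
    apply hk
    have hc' : c = c₀ := hinj hc
    subst hc'
    exact ⟨j, rfl⟩

/-- The top indicator count is the cardinality of the top fibre. [folklore] -/
theorem tsum_top_indicator_eq_card {C : Type*} {β : C → Type*} [∀ c, Fintype (β c)] (lam : C → ℝ) (hinj : Injective lam)
    (c₀ : C) : (∑' k : (Σ c, β c), if lam k.1 = lam c₀ then (1 : ℝ) else 0) = Fintype.card (β c₀) := by
  rw [tsum_top_eq_sum lam hinj c₀ (fun _ => (1 : ℝ)), Finset.sum_const, Finset.card_univ, nsmul_eq_mul, mul_one]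

/-! ## §3 The contraction property of the projected operator -/

variable {H : Type*} [NormedAddCommGroup H] [InnerProductSpace ℂ H]

/-- `‖v − ⟪e, v⟫ e‖ ≤ ‖v‖` for a unit vector `e` (Bessel). [cite: ReedSimonI1980, Thm II.1] -/
theorem norm_proj_orth_le {e : H} (he : ‖e‖ = 1) (v : H) : ‖(1 - (innerSL ℂ e).smulRight e : H →L[ℂ] H) v‖ ≤ ‖v‖ := by
  rw [sub_apply, one_apply_eq_self, MixtureAlgebra.rankOne_apply]
  have h : ‖v - ⟪e, v⟫_ℂ • e‖ ^ 2 = ‖v‖ ^ 2 - ‖⟪e, v⟫_ℂ‖ ^ 2 := by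
    rw [norm_sub_sq (𝕜 := ℂ), inner_smul_right, norm_smul, he, mul_one, ← inner_conj_symm v e, RCLike.mul_conj,
      ← RCLike.ofReal_pow, RCLike.ofReal_re]
    ring
  have h2 : ‖v - ⟪e, v⟫_ℂ • e‖ ^ 2 ≤ ‖v‖ ^ 2 := by rw [h]; linarith [sq_nonneg ‖⟪e, v⟫_ℂ‖]
  exact (pow_le_pow_iff_left₀ (norm_nonneg _) (norm_nonneg _) two_ne_zero).1 h2

/-- **The projected operator of the top class is a contraction**: if `‖A g‖ ≤ λ ‖g‖`, `λ > 0` and `‖e‖ = 1`, then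
`‖λ⁻¹ (1−R) A (1−R) v‖ ≤ ‖v‖`. [cite: ReedSimonI1980, Thm VI.16] -/
theorem norm_projected_le {A : H →L[ℂ] H} {e : H} {lam : ℝ} (he : ‖e‖ = 1) (hlam : 0 < lam) (hA : ∀ g, ‖A g‖ ≤ lam * ‖g‖)
    (v : H) :
    ‖((((lam : ℝ) : ℂ))⁻¹ • ((1 - (innerSL ℂ e).smulRight e) * A * (1 - (innerSL ℂ e).smulRight e)) : H →L[ℂ] H) v‖ ≤ ‖v‖ := by
  rw [_root_.smul_apply, norm_smul, norm_inv, Complex.norm_real, Real.norm_eq_abs, abs_of_pos hlam,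
    mul_apply_eq_comp, mul_apply_eq_comp]
  calc lam⁻¹ * ‖(1 - (innerSL ℂ e).smulRight e : H →L[ℂ] H) (A ((1 - (innerSL ℂ e).smulRight e : H →L[ℂ] H) v))‖
      ≤ lam⁻¹ * (lam * ‖(1 - (innerSL ℂ e).smulRight e : H →L[ℂ] H) v‖) := by
        refine mul_le_mul_of_nonneg_left ?_ (inv_nonneg.2 hlam.le)
        exact (norm_proj_orth_le he _).trans (hA _)
    _ = ‖(1 - (innerSL ℂ e).smulRight e : H →L[ℂ] H) v‖ := by field_simp
    _ ≤ ‖v‖ := norm_proj_orth_le he v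

/-! ## §4 Variance is non-negative (Cauchy–Schwarz over the top fibre) -/

/-- `(Σ_j Re γ_j)² ≤ |fibre| · Σ_j ‖γ_j‖²`. [folklore] -/
theorem sq_sum_re_le {ι : Type*} [Fintype ι] (γ : ι → ℂ) :
    (∑ j, (γ j).re) ^ 2 ≤ (Fintype.card ι : ℝ) * ∑ j, ‖γ j‖ ^ 2 := by
  have h1 : (∑ j, (γ j).re) ^ 2 ≤ ((Finset.univ : Finset ι).card : ℝ) * ∑ j, (γ j).re ^ 2 := by
    have h := sq_sum_le_card_mul_sum_sq (s := (Finset.univ : Finset ι)) (f := fun j => (γ j).re)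
    exact_mod_cast h
  have h2 : ∑ j, (γ j).re ^ 2 ≤ ∑ j, ‖γ j‖ ^ 2 :=
    Finset.sum_le_sum fun j _ => by
      have h := abs_le.1 (Complex.abs_re_le_norm (γ j))
      exact sq_le_sq' h.1 h.2
  rw [Finset.card_univ] at h1
  exact h1.trans (mul_le_mul_of_nonneg_left h2 (Nat.cast_nonneg _))

end Summit.QuantumFields.YangMills.Theorems.TorusKL.OSData

end
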